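import Summits.ResolutionOfSingularities.ResolutionOfSingularities.Theses.DefectlessFrames
import Literature.AlgebraicGeometry.Resolution.ResolutionOfSingularities
import Literature.AlgebraicGeometry.Resolution.QuasiExcellentSchemes
import Mathlib

/-!
# Crux `PatchingRelPerfect` (stmt-ResolutionOfSingularities-16161) — crux-ideate round 1, ideator 1:
# sketch for the idea card `perfect-closed-points`

The crux is `∀ p prime, RelLUPerfect p → ResPerfect p` (Zariski patching over PERFECT ground fields).
This file types the two punctual atoms of the card and the shape of its engine; the final composition
`patchingRelPerfect_of_cplusPerf` is kernel-checked modulo the ONE sorried engine theorem.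

* `CPlusPerf p n`  — regular-roof atom over perfect ground fields: strong punctual resolution of an integral
  `T` proper birational over a REGULAR local `S` essentially of finite type over a perfect `k`, `dim S ≤ n`,
  regular off the closed fibre, by a resolution that is an isomorphism over `Reg T` (ALL points of smooth
  `k`-varieties: the residue field of `S` is finitely generated over `k`, not necessarily perfect).
* `FibreFreePerfClosed p n` — the same over `S` at a CLOSED point (`S ⧸ 𝔪` finite over `k`, hence perfect),
  asking only for an isomorphism off the closed fibre (fibre freedom).
* `resPerfect_of_cplusPerf` (engine, sorried: regular-roof S1–S5 run over one perfect field),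
  `resPerfect_dim_le_four` (first open slice, sorried: closed-point concentration + CP2019 below dimension 4),
  `patchingRelPerfect_of_cplusPerf` (PROVED composition concluding the route decl by name).
-/

noncomputable section

open CategoryTheory AlgebraicGeometry
open Literature.AlgebraicGeometry.Resolution

namespace Summit.ResolutionOfSingularities.ResolutionOfSingularities.Cruxes.PatchingRelPerfect.PerfectClosedPoints

/-- ANTECEDENT of the crux at `p` (verbatim): relative local uniformization over perfect fields of
characteristic `p`. -/
def RelLUPerfect (p : ℕ) : Prop :=
  ∀ (k K : Type) [Field k] [CharP k p] [PerfectField k] [Field K] [Algebra k K],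
    (⊤ : IntermediateField k K).FG → ∀ O : ValuationSubring K, (∀ c : k, algebraMap k K c ∈ O) →
      ∀ R : Subalgebra k K, R.FG → R.toSubring ≤ O.toSubring →
        ∃ (A : Subalgebra k K) (h : A.toSubring ≤ O.toSubring), R ≤ A ∧ A.FG ∧
          IsFractionRing A K ∧ IsRegularLocalRing (Localization.AtPrime
            (Ideal.comap (Subring.inclusion h) (IsLocalRing.maximalIdeal O)))

/-- CONSEQUENT of the crux at `p` (verbatim): resolution of reduced separated finite-type schemes over
perfect fields of characteristic `p`. -/
def ResPerfect (p : ℕ) : Prop :=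
  ∀ (k : Type) [Field k] [CharP k p] [PerfectField k] (X : Scheme.{0}) (f : X ⟶ Spec (.of k)),
    IsSeparated f → LocallyOfFiniteType f → QuasiCompact f → IsReduced X → Scheme.HasResolution X

/-- Read-back: the route decl is literally `∀ p prime, RelLUPerfect p → ResPerfect p`. -/
theorem patchingRelPerfect_iff :
    Theses.DefectlessFrames.PatchingRelPerfect ↔ ∀ p : ℕ, p.Prime → RelLUPerfect p → ResPerfect p :=
  Iff.rfl

/-- ALL-DIMENSIONAL ATOM `C⁺Perf(n)` — strong punctual resolution over REGULAR local bases of dimension `≤ n`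
essentially of finite type over a PERFECT field (regular-roof's `C⁺_n` with `[PerfectField k]`): for such
`S` and an integral `T` proper and birational over `Spec S`, regular off the closed fibre, there is a
resolution `π : T' → T` which is an isomorphism over `Reg T`. `n ≤ 3`: Cossart–Piltant 2019 Thm 1.1 (ii).
Open for `n ≥ 4`. -/
def CPlusPerf (p n : ℕ) : Prop :=
  ∀ (k : Type) [Field k] [CharP k p] [PerfectField k] (S : Type) [CommRing S] [IsRegularLocalRing S]
    [Algebra k S] [Algebra.EssFiniteType k S], ringKrullDim S ≤ n →
    ∀ (T : Scheme.{0}) (f : T ⟶ Spec (.of S)), IsIntegral T → IsProper f → IsBirational f →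
    (∀ t : T, f.base t ≠ IsLocalRing.closedPoint S → IsRegularLocalRing (T.presheaf.stalk t)) →
    ∃ (T' : Scheme.{0}) (π : T' ⟶ T), IsResolution π ∧
      ∃ U : T.Opens, (U : Set T) = Scheme.regularLocus T ∧ IsIso (π ∣_ U)

/-- FIRST-SLICE ATOM `FibreFreePerfClosed(n)` — fibre-free punctual resolution over a regular local base of
dimension `≤ n` essentially of finite type over a PERFECT field `k` AT A CLOSED POINT (`S ⧸ 𝔪_S` finite over
`k`, hence a perfect field): `π : T' → T` need only be an isomorphism off the closed fibre. This is where a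
perfect ground field delivers a perfect RESIDUE field to the 4-dimensional local analysis. -/
def FibreFreePerfClosed (p n : ℕ) : Prop :=
  ∀ (k : Type) [Field k] [CharP k p] [PerfectField k] (S : Type) [CommRing S] [IsRegularLocalRing S]
    [Algebra k S] [Algebra.EssFiniteType k S], ringKrullDim S ≤ n →
    Module.Finite k (S ⧸ IsLocalRing.maximalIdeal S) →
    ∀ (T : Scheme.{0}) (f : T ⟶ Spec (.of S)), IsIntegral T → IsProper f → IsBirational f →
    (∀ t : T, f.base t ≠ IsLocalRing.closedPoint S → IsRegularLocalRing (T.presheaf.stalk t)) →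
    ∃ (T' : Scheme.{0}) (π : T' ⟶ T), IsResolution π ∧
      ∃ U : T.Opens, (∀ t : T, t ∈ U ↔ f.base t ≠ IsLocalRing.closedPoint S) ∧ IsIso (π ∣_ U)

/-- ENGINE (to be built by crux-plan; regular-roof S1–S5 of the twin crux run over ONE perfect field `k`):
relative LU + quasi-compactness of the Zariski–Riemann space give a finite resolving system and its join `M`,
covered by roofs `Wᵢ = pᵢ⁻¹(Reg Mᵢ)`; noetherian induction on the closed bad set `B ⊆ M`, each step an instance
of `C⁺Perf` at the local ring of a regular roof, glued along `Reg` and Nagata-compactified; components + Chow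
+ projective closure for reduced separated finite-type `X`. -/
theorem resPerfect_of_cplusPerf (p : ℕ) (hp : p.Prime) (hC : ∀ n : ℕ, CPlusPerf p n)
    (hLU : RelLUPerfect p) : ResPerfect p := by
  sorry

/-- FIRST OPEN SLICE (to be built by crux-plan; closed-point concentration): modulo Cossart–Piltant 2019
(strong resolution of reduced quasi-excellent schemes of dimension `≤ 3`, ALL residue fields — used at the
NON-closed bad points, whose local rings on the join have dimension `≤ 3`), relative LU over perfect fields and
the fibre-free atom at PERFECT CLOSED points in dimension `4` resolve every reduced separated finite-type
scheme of dimension `≤ 4` over every perfect field of characteristic `p`. -/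
theorem resPerfect_dim_le_four (h : CossartPiltant2019General.{0}) (p : ℕ) (hp : p.Prime)
    (hLU : RelLUPerfect p) (hFF : FibreFreePerfClosed p 4) :
    ∀ (k : Type) [Field k] [CharP k p] [PerfectField k] (X : Scheme.{0}) (f : X ⟶ Spec (.of k)),
      IsSeparated f → LocallyOfFiniteType f → QuasiCompact f → IsReduced X →
      topologicalKrullDim X ≤ 4 → Scheme.HasResolution X := by
  sorry

/-- COMPOSITION (kernel-checked modulo the engine): the all-dimensional atom closes the crux BY NAME. -/
theorem patchingRelPerfect_of_cplusPerf (hC : ∀ p : ℕ, p.Prime → ∀ n : ℕ, CPlusPerf p n) :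
    Theses.DefectlessFrames.PatchingRelPerfect :=
  fun p hp hLU => resPerfect_of_cplusPerf p hp (hC p hp) hLU

end Summit.ResolutionOfSingularities.ResolutionOfSingularities.Cruxes.PatchingRelPerfect.PerfectClosedPoints
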